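import Literature.AnabelianGeometry.EtaleTheta.GalSectThm110iiiEndKnitX
import Literature.AnabelianGeometry.EtaleTheta.GalSectMuTwoTransport
import HarnessLib

/-!
# [EtTh] Thm. 1.10 (iii), ONE closer with the X-level residual — (μ) replaced by (μtor)

The closers `thm110iiiGalSect_of_cuspDecompTransport` (p438817) and `thm110iiiGalSect_of_Xlevel` (p442622) of
abc-iut-w5-d062 take the input (μ) «`±1 ↦ ±1`» quantified over every `c ∈ Π^tp_{Ċβ}`, every class map `e` and
every intertwining `δ`.  By `DotCCusp.hμ_of_twoTorsion` (`GalSectMuTwoTransport`) that input follows from (b1)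
— which these closers DERIVE from (x) — and the `c`-free classical fact (μtor) «the `2`-torsion of `(K^×)^∧` is
`μ₂(K)`» at `α` and at `β`.  This file re-knits both closers with (μtor) in place of (μ):

* `thm110iiiGalSect_of_cuspDecompTransport_twoTorsion`;
* `thm110iiiGalSect_of_Xlevel_twoTorsion` — `Thm110iiiGalSect` from: the law, the topological side
  conditions, (x) X-level cusp decomposition transport, (ct) ×2, (ΔX), (nX) ×2, (tf), (gen) ×2, (μtor) ×2,
  (b3) — every input a printed inference, a cited result or a classical fact, none mentioning the class
  transport's intertwiner.

HONEST FRAMING: inputs are named, not asserted; typed ≠ proved; no side taken on [IUTchIII] Cor. 3.12, on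
which nothing here bears.
-/

namespace Literature.AnabelianGeometry.EtaleTheta

open scoped Pointwise
open Literature.AnabelianGeometry.SemiGraphs

section EndKnitXTor

variable {p : ℕ} [Fact p.Prime] {Mα Mβ : MuTwoSetting p} {εα : Mα.GtpC} {εβ : Mβ.GtpC}
  {hCα : Mα.toThetaSetting.Compat} {hCβ : Mβ.toThetaSetting.Compat}
  {Eα : Mα.toThetaSetting.EtaleThetaData} {Eβ : Mβ.toThetaSetting.EtaleThetaData}
  {γ : Mα.dotC εα ≃ₜ* Mβ.dotC εβ}

/-- **Thm. 1.10 (iii) from the X-level cusp decomposition transport (x) + (ct) + (Δ), with (μtor) in place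
of (μ)** (re-knit of p438817's `thm110iiiGalSect_of_cuspDecompTransport` through
`thm110iiiGalSect_of_genuineTorsor_twoTorsion`). [cite: MochizukiEtTh2009, Thm 1.10 (iii) p.30] -/
theorem thm110iiiGalSect_of_cuspDecompTransport_twoTorsion [T1Space Mα.GtpC] [T1Space Mβ.GtpC]
    (H : Thm110Hypothesis εα εβ hCα hCβ Eα Eβ γ)
    (Sα : Mα.StandardData Eα.toKummerData) (Sβ : Mβ.StandardData Eβ.toKummerData)
    (Cα : Mα.DotCCusp εα) (Cβ : Mβ.DotCCusp εβ)
    [IsMulCommutative Cα.pair.I] [IsMulCommutative Cβ.pair.I]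
    (hDα : IsClosed (Cα.pair.D : Set Mα.GtpC)) (hIα : IsCompact (Cα.pair.I : Set Mα.GtpC))
    (hDβ : IsClosed (Cβ.pair.D : Set Mβ.GtpC)) (hIβ : IsCompact (Cβ.pair.I : Set Mβ.GtpC))
    -- (law)
    (hcan : Cα.torsor.IsStructure (GalSect.unitsHat Mα.toThetaSetting.toTemperedCurve) Cα.canonical)
    -- (x) + (ct) + (Δ)
    {σ : Mβ.PiTemp} (hσ : Mβ.inclX σ ∈ Mβ.dotC εβ)
    (hX : (MulAut.conj Cα.conj • Mα.decomp Cα.cusp).map H.γX.toMulEquiv.toMonoidHom =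
      MulAut.conj σ • (MulAut.conj Cβ.conj • Mβ.decomp Cβ.cusp))
    (hCTα : ∀ g ∈ Mα.dotC εα, Subgroup.Commensurable (MulAut.conj g • Cα.pair.D) Cα.pair.D → g ∈ Cα.pair.D)
    (hCTβ : ∀ g ∈ Mβ.dotC εβ, Subgroup.Commensurable (MulAut.conj g • Cβ.pair.D) Cβ.pair.D → g ∈ Cβ.pair.D)
    (hΔ : Cα.augC.ker.map H.Γ.toMulEquiv.toMonoidHom = Cβ.augC.ker)
    -- (gen) Kummer identification of the two cusp torsors
    {S₀α : Subgroup Mα.GtpC} (hS₀α : S₀α ∈ Cα.pair.splittings)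
    {S₀β : Subgroup Mβ.GtpC} (hS₀β : S₀β ∈ Cβ.pair.splittings)
    (hgenα : haveI := Cα.pair.ID_normal
      ∃ κ : GalSect.KxHat Mα.toThetaSetting.toTemperedCurve ≃*
          ↥(ContH1.resKer Cα.pair.ID (⊤ : Subgroup Cα.pair.D)
            (Cα.pair.isClosedComplement_of_mem_splittings hS₀α).le_left),
        ∀ k cl, Cα.torsor.act k cl = (Cα.pair.torsorDataH1 hDα hIα hS₀α).act (κ k) cl)
    (hgenβ : haveI := Cβ.pair.ID_normal
      ∃ κ : GalSect.KxHat Mβ.toThetaSetting.toTemperedCurve ≃*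
          ↥(ContH1.resKer Cβ.pair.ID (⊤ : Subgroup Cβ.pair.D)
            (Cβ.pair.isClosedComplement_of_mem_splittings hS₀β).le_left),
        ∀ k cl, Cβ.torsor.act k cl = (Cβ.pair.torsorDataH1 hDβ hIβ hS₀β).act (κ k) cl)
    -- (μtor) ×2, and (b3) for the class transport along `Γ ∘ Inn c`, every `c ∈ Π^tp_{Ċβ}`
    (htorα : ∀ x : GalSect.KxHat Mα.toThetaSetting.toTemperedCurve, x * x = 1 → x ∈ Mα.muTwoHat)
    (htorβ : ∀ x : GalSect.KxHat Mβ.toThetaSetting.toTemperedCurve, x * x = 1 → x ∈ Mβ.muTwoHat)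
    (hecan : ∀ c ∈ Mβ.dotC εβ, ∀ (e : Cα.pair.SplittingClass → Cβ.pair.SplittingClass),
      (∀ (S : Subgroup Mα.GtpC) (hS : S ∈ Cα.pair.splittings),
        ∃ h', e (GalSect.CuspPair.SplittingClass.mk Cα.pair S hS) =
          GalSect.CuspPair.SplittingClass.mk Cβ.pair
            (S.map (H.Γ.trans (Mβ.innerAutC c)).toMulEquiv.toMonoidHom) h') →
      e '' Cα.canonical ⊆ Cβ.canonical) :
    Thm110iiiGalSect H Sα Sβ Cα Cβ := by
  obtain ⟨c, hc, hpair⟩ := Cα.hpair_of_cuspDecompTransport H Cβ hσ hX hCTα hCTβ hΔ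
  exact thm110iiiGalSect_of_genuineTorsor_twoTorsion H Sα Sβ Cα Cβ hDα hIα hDβ hIβ hcan hc hpair hS₀α hS₀β
    hgenα hgenβ htorα htorβ (hecan c hc)

/-- **[EtTh] Thm. 1.10 (iii), ONE closer with the fully X-level residual and (μtor) in place of (μ)**
(re-knit of p442622's `thm110iiiGalSect_of_Xlevel`): `Thm110iiiGalSect` from the law, the topological side
conditions, (x), (ct) ×2, (ΔX), (nX) ×2, (tf), (gen) ×2, (μtor) ×2 and (b3).
[cite: MochizukiEtTh2009, Thm 1.10 (iii) p.30] -/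
theorem thm110iiiGalSect_of_Xlevel_twoTorsion [T1Space Mα.GtpC] [T1Space Mβ.GtpC]
    (H : Thm110Hypothesis εα εβ hCα hCβ Eα Eβ γ)
    (Sα : Mα.StandardData Eα.toKummerData) (Sβ : Mβ.StandardData Eβ.toKummerData)
    (Cα : Mα.DotCCusp εα) (Cβ : Mβ.DotCCusp εβ)
    [IsMulCommutative Cα.pair.I] [IsMulCommutative Cβ.pair.I]
    (hDα : IsClosed (Cα.pair.D : Set Mα.GtpC)) (hIα : IsCompact (Cα.pair.I : Set Mα.GtpC))
    (hDβ : IsClosed (Cβ.pair.D : Set Mβ.GtpC)) (hIβ : IsCompact (Cβ.pair.I : Set Mβ.GtpC))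
    -- (law)
    (hcan : Cα.torsor.IsStructure (GalSect.unitsHat Mα.toThetaSetting.toTemperedCurve) Cα.canonical)
    -- (x) + (ct)
    {σ : Mβ.PiTemp} (hσ : Mβ.inclX σ ∈ Mβ.dotC εβ)
    (hX : (MulAut.conj Cα.conj • Mα.decomp Cα.cusp).map H.γX.toMulEquiv.toMonoidHom =
      MulAut.conj σ • (MulAut.conj Cβ.conj • Mβ.decomp Cβ.cusp))
    (hCTα : ∀ g ∈ Mα.dotC εα, Subgroup.Commensurable (MulAut.conj g • Cα.pair.D) Cα.pair.D → g ∈ Cα.pair.D)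
    (hCTβ : ∀ g ∈ Mβ.dotC εβ, Subgroup.Commensurable (MulAut.conj g • Cβ.pair.D) Cβ.pair.D → g ∈ Cβ.pair.D)
    -- (ΔX) + (nX) + (tf)
    (hΔX : (Mα.aug.toMonoidHom.ker).map H.γX.toMulEquiv.toMonoidHom = Mβ.aug.toMonoidHom.ker)
    (hnα : ¬ Cα.augC.ker ≤ Mα.inclX.range) (hnβ : ¬ Cβ.augC.ker ≤ Mβ.inclX.range)
    (htf : ∀ x : Mβ.PiTemp, Mβ.aug x * Mβ.aug x = 1 → Mβ.aug x = 1)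
    -- (gen)
    {S₀α : Subgroup Mα.GtpC} (hS₀α : S₀α ∈ Cα.pair.splittings)
    {S₀β : Subgroup Mβ.GtpC} (hS₀β : S₀β ∈ Cβ.pair.splittings)
    (hgenα : haveI := Cα.pair.ID_normal
      ∃ κ : GalSect.KxHat Mα.toThetaSetting.toTemperedCurve ≃*
          ↥(ContH1.resKer Cα.pair.ID (⊤ : Subgroup Cα.pair.D)
            (Cα.pair.isClosedComplement_of_mem_splittings hS₀α).le_left),
        ∀ k cl, Cα.torsor.act k cl = (Cα.pair.torsorDataH1 hDα hIα hS₀α).act (κ k) cl)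
    (hgenβ : haveI := Cβ.pair.ID_normal
      ∃ κ : GalSect.KxHat Mβ.toThetaSetting.toTemperedCurve ≃*
          ↥(ContH1.resKer Cβ.pair.ID (⊤ : Subgroup Cβ.pair.D)
            (Cβ.pair.isClosedComplement_of_mem_splittings hS₀β).le_left),
        ∀ k cl, Cβ.torsor.act k cl = (Cβ.pair.torsorDataH1 hDβ hIβ hS₀β).act (κ k) cl)
    -- (μtor) ×2
    (htorα : ∀ x : GalSect.KxHat Mα.toThetaSetting.toTemperedCurve, x * x = 1 → x ∈ Mα.muTwoHat)
    (htorβ : ∀ x : GalSect.KxHat Mβ.toThetaSetting.toTemperedCurve, x * x = 1 → x ∈ Mβ.muTwoHat)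
    (hecan : ∀ c ∈ Mβ.dotC εβ, ∀ (e : Cα.pair.SplittingClass → Cβ.pair.SplittingClass),
      (∀ (S : Subgroup Mα.GtpC) (hS : S ∈ Cα.pair.splittings),
        ∃ h', e (GalSect.CuspPair.SplittingClass.mk Cα.pair S hS) =
          GalSect.CuspPair.SplittingClass.mk Cβ.pair
            (S.map (H.Γ.trans (Mβ.innerAutC c)).toMulEquiv.toMonoidHom) h') →
      e '' Cα.canonical ⊆ Cβ.canonical) :
    Thm110iiiGalSect H Sα Sβ Cα Cβ :=
  thm110iiiGalSect_of_cuspDecompTransport_twoTorsion H Sα Sβ Cα Cβ hDα hIα hDβ hIβ hcan hσ hX hCTα hCTβ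
    (Cα.augC_ker_map_eq H Cβ hΔX hnα hnβ htf) hS₀α hS₀β hgenα hgenβ htorα htorβ hecan

end EndKnitXTor

end Literature.AnabelianGeometry.EtaleTheta
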